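import Summits.QuantumFields.BalabanUV.T4Continuum.Support.VariationalEffectiveOperator
import Summits.QuantumFields.BalabanUV.T4Continuum.Support.VariationalCovariantScalarPair

/-!
# T⁴ programme, spine node NE2 (U1a), lane P2 — LEAF D ON THE CARRIERS: the Hermitian effective operators `X_k(Ū′)`, `X_{k+1}(U′)`
# of the charged scalar's constrained covariant Dirichlet minimisations (transported block average `Q_T`, covariant Laplacian
# `Σ_μ D_μᴴD_μ`, the canonical pair `Q_T ∘ Q_{T′}`), and the OP-NORM END of `VariationalCovariantScalarPair.scalar_pair_bracket`
# (`t4/skeletons/NE2-t4-ne2-p2.md` v0.6 §2.C leaf D / §7 supplier cut s1; cell `pub-balaban`, NE2 formalisation swarm, unit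
# `b2b-balaban-t4-ne2-formalise-leaf-02` gen 3, supplier to the row-NE2 co-owner lineage t4-ne2-p2)

HONEST FRAMING (T4-DAG p. 1).  Rung (B)+1 only — NOT infinite volume, NOT a mass gap, NOT Clay.  Node NE2 is NOT IN PRINT and NOT
proved here.  MODEL LEVEL: U(1) bond phases `Rc`, `R′`, site transports `T`, `T′` and the global frames of leaf P⁺ are DATA; scalar
(0-form) sector; OUR statements, finite-dimensional linear algebra ([folklore]); nothing printed is a hypothesis; no `def … : Prop` fact;
no `sorry`; axioms standard.  HONEST DEPENDENCY (cell, verbatim): continuum YM on T⁴ ⇐ BetaPertH ∧ nine spine estimates (0/9 proved);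
BetaPertH ⇐ (D1) ∧ (D4) ∧ CAP+tail; G-an2-4 gates asym, D1 and NE2/3/4.

CONTENTS (companion of `Support/VariationalEffectiveOperator`, whose abstract `effOp` / `blockSpin_eq_effOp` /
`opNorm_effOp_sub_le_of_bracket` are instantiated on the objects `Sc`/`Sf`/`qW`/`qV`/`Qk`/`Q1` of `VariationalCovariantScalarPair` p211992):
* §1 the transported block average as a MATRIX `QTm n M T := Q′·diag T` (`QTm_mulVec : QTm *ᵥ f = QT n M T f`, `Qk_eq_mulVec : Qk n M T =
  (QTm n M T).mulVec`, `Qk_comp_Q1_eq_mulVec`), SURJECTIVE for unimodular transports (`QTm_mulVec_surjective`, right inverse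
  `x ↦ conj T(x)·μ(blockOf x)`);
* §2 the covariant forward difference `covD N R μ := diag(R(·,μ))·S_μ − 1` (`covD_mulVec = cD`) and the covariant Laplacian
  `Kdir N R := Σ_μ covDᴴ·covD` (positive semidefinite; `qform_Kdir : qform K_R f = Σ_μ dirU N R f μ`), hence
  `Sc n M Rc = qform ((n²/n^d)•K_{Rc})`, `Sf n L M R′ = qform (((nL)²/(nL)^d)•K_{R′})` (`Sc_eq_qform`, `Sf_eq_qform`);
* §3 KER from leaf P⁺'s coercivity SHAPE at either level (`ker_coarse` ⇐ any `qW f ≤ C_P(Sc f + nsq (Q_T f))`, `ker_fine` ⇐ any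
  `qV f′ ≤ C_P(Sf f′ + nsq (Q_T Q_{T′} f′))` — supplied by `VariationalCovariantScalarPair.qW_le_coarse` / `qV_le_composite`);
* §4 THE EFFECTIVE OPERATORS **`effSc n M Rc T a`** = `X_k(Ū′)` and **`effSf n L M R′ T T′ a`** = `X_{k+1}(U′)` (Hermitian matrices on the
  unit torus `Tor M`), leaf D: **`blockSpin_Sc_eq : Δ′_k(Ū′)(μ) = blockSpin (Qk T) (Sc Rc) μ = re μ†X_kμ`**, **`blockSpin_Sf_eq`** (composite
  level), **`opNorm_effSf_sub_effSc_le_of_bracket`** (the two one-sided additive brackets ⟹ `‖X_{k+1} − X_k‖ ≤ max e e′`), and the headline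
  **`opNorm_scalarPair_le`**: under EXACTLY the hypotheses of `scalar_pair_bracket` (global small-field frames, mismatch absorption,
  leaves UB⁺/ONE⁺/REG⁺ ASSUMED in their typed shapes) plus unimodular `T`, the canonical pair's increment IN ROW NE2's CONSUMER CURRENCY:
  `‖X_{k+1}(U′) − X_k(Ū′)‖_op ≤ max e e′`, `e = 2δ√(ΛC_P(Λ+1)) + δ²C_P(Λ+1)`, `δ = √d·(n·m)`, `C_P = 1088d + 128`, `e′ = (ε₁C_R + ε₂C_P)(Λ+1)`.
  Nothing of NE3; UB⁺/ONE⁺/REG⁺ stay binders (not touched here); the independence of `a > 0` is `effOp_eq_effOp`.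
-/

noncomputable section

open scoped Matrix ComplexConjugate ComplexOrder Matrix.Norms.L2Operator BigOperators

namespace Summit.QuantumFields.BalabanUV.T4Continuum.VariationalCovariantEffective

open Summit.QuantumFields.BalabanUV.T4Continuum.VariationalTransfer (blockSpin)
open Summit.QuantumFields.BalabanUV.T4Continuum.VariationalEffectiveOperator
open Summit.QuantumFields.BalabanUV.T4Continuum.BalabanAveragedCoerciveFibre (star_dotProduct_conjTranspose_mulVec)
open Literature.MathematicalPhysics.QuantumFieldTheory.Balaban1983to89.B5Prop11Lower (nsq nsq_nonneg star_dotProduct_self)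
open Literature.MathematicalPhysics.QuantumFieldTheory.Balaban1983to89.B5Prop11Plancherel (Tor fine unitVec)
open Literature.MathematicalPhysics.QuantumFieldTheory.Balaban1983to89.B5Block118 (bpt QsOp QsOp_mulVec)
open Literature.MathematicalPhysics.QuantumFieldTheory.Balaban1983to89.B5Blocks16 (blockOf blockOf_bpt QsOp_blockConst)
open Literature.MathematicalPhysics.QuantumFieldTheory.Balaban1983to89.B5Action121 (shiftS shiftS_mulVec)
open Literature.Analysis.Complex (qform qform_smul qform_nonneg_of_posSemidef)
open Summit.QuantumFields.BalabanUV.T4Continuum.VariationalCovariantPoincare (QT)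
open Summit.QuantumFields.BalabanUV.T4Continuum.VariationalCovariantFederbush (cD dirU dirU_nonneg Qc mis)
open Summit.QuantumFields.BalabanUV.T4Continuum.VariationalCovariantScalarPair (Sc Sf qW qV Qk Q1 qW_le_coarse qV_le_composite
  scalar_pair_bracket)

variable {d : ℕ}

/-! ## §1 The transported block average as a matrix -/

section Average

variable (n : ℕ) [NeZero n] (M : Fin d → ℕ) [hM : ∀ μ, NeZero (M μ)]

/-- the transported block average `Q_T = Q′ · diag T` as a matrix `T₁ ← T_η` ([B9] (3.19) SHAPE, abelian, transports as data).
[folklore] -/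
def QTm (T : Tor (fine n M) → ℂ) : Matrix (Tor M) (Tor (fine n M)) ℂ := QsOp n M * Matrix.diagonal T

/-- `Q_T` acts as the transported block average `VariationalCovariantPoincare.QT` (= `VariationalCovariantFederbush.Qc` by `rfl`).
[folklore] -/
theorem QTm_mulVec (T f : Tor (fine n M) → ℂ) : QTm n M T *ᵥ f = QT n M T f := by
  funext z
  rw [QTm, ← Matrix.mulVec_mulVec, QsOp_mulVec, QT, one_div]
  refine congrArg _ (Finset.sum_congr rfl fun j _ => ?_)
  rw [Matrix.mulVec_diagonal]

/-- `VariationalCovariantScalarPair.Qk n M T` IS the linear map of the matrix `QTm n M T`. [folklore] -/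
theorem Qk_eq_mulVec (T : Tor (fine n M) → ℂ) : Qk n M T = (QTm n M T).mulVec := by
  funext f; exact (QTm_mulVec n M T f).symm

/-- **SURJECTIVITY** of the transported block average for unimodular site transports: `x ↦ conj T(x)·μ(block of x)` is a right
inverse (`B5Blocks16.QsOp_blockConst`). [folklore] -/
theorem QTm_mulVec_surjective {T : Tor (fine n M) → ℂ} (hT : ∀ x, ‖T x‖ = 1) : Function.Surjective (QTm n M T).mulVec := by
  intro μ
  refine ⟨fun x => conj (T x) * μ (blockOf n M x), ?_⟩
  have h1 : Matrix.diagonal T *ᵥ (fun x => conj (T x) * μ (blockOf n M x)) = fun x => μ (blockOf n M x) := by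
    funext x
    rw [Matrix.mulVec_diagonal, ← mul_assoc, Complex.mul_conj, Complex.normSq_eq_norm_sq, hT]
    simp
  show QTm n M T *ᵥ _ = μ
  rw [QTm, ← Matrix.mulVec_mulVec, h1, QsOp_blockConst]

variable (L : ℕ) [NeZero L]

/-- the composite constraint `Q_T ∘ Q_{T′}` of the canonical pair is the linear map of the matrix product. [folklore] -/
theorem Qk_comp_Q1_eq_mulVec (T : Tor (fine n M) → ℂ) (T' : Tor (fine L (fine n M)) → ℂ) :
    Qk n M T ∘ Q1 n L M T' = (QTm n M T * QTm L (fine n M) T').mulVec := by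
  rw [mulVec_comp_eq, ← Qk_eq_mulVec]
  have h : Q1 n L M T' = (QTm L (fine n M) T').mulVec := by
    funext f'; exact (QTm_mulVec L (fine n M) T' f').symm
  rw [h]

/-- surjectivity of the composite constraint (both transports unimodular). [folklore] -/
theorem QTm_comp_mulVec_surjective {T : Tor (fine n M) → ℂ} (hT : ∀ x, ‖T x‖ = 1) {T' : Tor (fine L (fine n M)) → ℂ}
    (hT' : ∀ x, ‖T' x‖ = 1) : Function.Surjective (QTm n M T * QTm L (fine n M) T').mulVec := by
  rw [mulVec_comp_eq]
  exact (QTm_mulVec_surjective n M hT).comp (QTm_mulVec_surjective L (fine n M) hT')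

end Average

/-! ## §2 The covariant difference and the covariant Laplacian as matrices -/

section Laplacian

variable (N : Fin d → ℕ) [hN : ∀ μ, NeZero (N μ)]

/-- the covariant forward difference `D_μ := diag(R(·,μ))·S_μ − 1`, `(D_μ f)(x) = R(x,μ)f(x+e_μ) − f(x)` ([B9] (3.3) SHAPE, abelian,
lattice units). [folklore] -/
def covD (R : Tor N → Fin d → ℂ) (μ : Fin d) : Matrix (Tor N) (Tor N) ℂ :=
  Matrix.diagonal (fun x => R x μ) * shiftS N μ - 1

/-- `D_μ` acts as `VariationalCovariantFederbush.cD`. [folklore] -/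
theorem covD_mulVec (R : Tor N → Fin d → ℂ) (μ : Fin d) (f : Tor N → ℂ) (x : Tor N) :
    (covD N R μ *ᵥ f) x = cD N R f x μ := by
  rw [covD, Matrix.sub_mulVec, ← Matrix.mulVec_mulVec, Pi.sub_apply, Matrix.mulVec_diagonal, shiftS_mulVec,
    Matrix.one_mulVec, cD]

/-- the covariant Laplacian `K_R := Σ_μ D_μᴴ D_μ` (the matrix of the covariant Dirichlet form). [folklore] -/
def Kdir (R : Tor N → Fin d → ℂ) : Matrix (Tor N) (Tor N) ℂ := ∑ μ, (covD N R μ)ᴴ * covD N R μ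

/-- `K_R` is positive semidefinite. [folklore] -/
theorem Kdir_posSemidef (R : Tor N → Fin d → ℂ) : (Kdir N R).PosSemidef :=
  Matrix.posSemidef_sum Finset.univ fun _ _ => Matrix.posSemidef_conjTranspose_mul_self _

/-- the form of `K_R` is the covariant Dirichlet sum: `f† K_R f = Σ_μ Σ_x |R(x,μ)f(x+e_μ) − f(x)|²`. [folklore] -/
theorem form_Kdir (R : Tor N → Fin d → ℂ) (f : Tor N → ℂ) :
    star f ⬝ᵥ (Kdir N R *ᵥ f) = ((∑ μ, dirU N R f μ : ℝ) : ℂ) := by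
  rw [Kdir, Matrix.sum_mulVec, dotProduct_sum]
  push_cast
  refine Finset.sum_congr rfl fun μ _ => ?_
  rw [← Matrix.mulVec_mulVec, star_dotProduct_conjTranspose_mulVec, star_dotProduct_self, dirU, nsq]
  congr 1
  exact Finset.sum_congr rfl fun x _ => by rw [covD_mulVec]

/-- `qform K_R f = Σ_μ dirU N R f μ`. [folklore] -/
theorem qform_Kdir (R : Tor N → Fin d → ℂ) (f : Tor N → ℂ) : qform (Kdir N R) f = ∑ μ, dirU N R f μ := by
  rw [qform, form_Kdir, Complex.ofReal_re]

/-- the scaled covariant Laplacian is positive semidefinite for `c ≥ 0`. [folklore] -/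
theorem smul_Kdir_posSemidef {c : ℝ} (hc : 0 ≤ c) (R : Tor N → Fin d → ℂ) : ((c : ℂ) • Kdir N R).PosSemidef := by
  refine Matrix.PosSemidef.of_dotProduct_mulVec_nonneg ((Kdir_posSemidef N R).1.smul (by
    rw [IsSelfAdjoint, Complex.star_def, Complex.conj_ofReal])) fun f => ?_
  rw [Matrix.smul_mulVec, dotProduct_smul, smul_eq_mul, form_Kdir]
  exact mul_nonneg (Complex.zero_le_real.mpr hc)
    (Complex.zero_le_real.mpr (Finset.sum_nonneg fun μ _ => dirU_nonneg N R f μ))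

end Laplacian

section Forms

variable (n L : ℕ) [NeZero n] [NeZero L] (M : Fin d → ℕ) [hM : ∀ μ, NeZero (M μ)]

omit [NeZero L] in
/-- `Sc n M Rc = qform ((n²/n^d) • K_{Rc})` — the level-`n` covariant Dirichlet form of `VariationalCovariantScalarPair` is the quadratic
form of the scaled covariant Laplacian. [folklore] -/
theorem Sc_eq_qform (Rc : Tor (fine n M) → Fin d → ℂ) :
    Sc n M Rc = qform ((((n : ℝ) ^ 2 / (n : ℝ) ^ d : ℝ) : ℂ) • Kdir (fine n M) Rc) := by
  funext f; rw [qform_smul, qform_Kdir]; rfl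

/-- `Sf n L M R′ = qform (((nL)²/(nL)^d) • K_{R′})`. [folklore] -/
theorem Sf_eq_qform (R' : Tor (fine L (fine n M)) → Fin d → ℂ) :
    Sf n L M R' = qform (((((n : ℝ) * L) ^ 2 / ((n : ℝ) * L) ^ d : ℝ) : ℂ) • Kdir (fine L (fine n M)) R') := by
  funext f'; rw [qform_smul, qform_Kdir]; rfl

end Forms

/-! ## §3 KER from leaf P⁺'s coercivity shape -/

section Ker

variable (n L : ℕ) [NeZero n] [NeZero L] (M : Fin d → ℕ) [hM : ∀ μ, NeZero (M μ)]

omit [NeZero L] in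
/-- **KER at level `n`**: any coercivity inequality `qW f ≤ C_P·(Sc f + nsq (Q_T f))` (leaf P⁺'s shape; `qW_le_coarse`) forces
`Sc f = 0 ∧ Q_T f = 0 ⇒ f = 0`, in the `(K, Q)`-matrix form consumed by `effOp`. [folklore] -/
theorem ker_coarse {Rc : Tor (fine n M) → Fin d → ℂ} {T : Tor (fine n M) → ℂ} {CP : ℝ}
    (hPc : ∀ f, qW n M f ≤ CP * (Sc n M Rc f + nsq (Qk n M T f))) :
    ∀ f, qform ((((n : ℝ) ^ 2 / (n : ℝ) ^ d : ℝ) : ℂ) • Kdir (fine n M) Rc) f = 0 → QTm n M T *ᵥ f = 0 → f = 0 := by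
  intro f hS hQ
  have hnd : (0 : ℝ) < (n : ℝ) ^ d := by have := NeZero.ne n; positivity
  have hS' : Sc n M Rc f = 0 := by rw [Sc_eq_qform]; exact hS
  have hQ' : Qk n M T f = 0 := by rw [Qk_eq_mulVec]; exact hQ
  have h := hPc f
  rw [hS', hQ'] at h
  have h0 : qW n M f ≤ 0 := by simpa [nsq] using h
  refine eq_zero_of_nsq_le_zero ?_
  unfold qW at h0
  by_contra hne
  push Not at hne
  have : 0 < ((n : ℝ) ^ d)⁻¹ * nsq f := mul_pos (inv_pos.mpr hnd) hne
  linarith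

/-- **KER for the composite level `nL`**: any `qV f′ ≤ C_P·(Sf f′ + nsq (Q_T (Q_{T′} f′)))` (`qV_le_composite`) forces the matrix-form
KER for `(((nL)²/(nL)^d)•K_{R′}, Q_T·Q_{T′})`. [folklore] -/
theorem ker_fine {R' : Tor (fine L (fine n M)) → Fin d → ℂ} {T : Tor (fine n M) → ℂ} {T' : Tor (fine L (fine n M)) → ℂ} {CP : ℝ}
    (hPf : ∀ f', qV n L M f' ≤ CP * (Sf n L M R' f' + nsq (Qk n M T (Q1 n L M T' f')))) :
    ∀ f', qform (((((n : ℝ) * L) ^ 2 / ((n : ℝ) * L) ^ d : ℝ) : ℂ) • Kdir (fine L (fine n M)) R') f' = 0 →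
      (QTm n M T * QTm L (fine n M) T') *ᵥ f' = 0 → f' = 0 := by
  intro f' hS hQ
  have hnd : (0 : ℝ) < ((n : ℝ) * L) ^ d := by have := NeZero.ne n; have := NeZero.ne L; positivity
  have hS' : Sf n L M R' f' = 0 := by rw [Sf_eq_qform]; exact hS
  have hQ' : Qk n M T (Q1 n L M T' f') = 0 := by
    have e := congrFun (Qk_comp_Q1_eq_mulVec n M L T T') f'
    simp only [Function.comp_apply] at e
    rw [e]; exact hQ
  have h := hPf f'
  rw [hS', hQ'] at h
  have h0 : qV n L M f' ≤ 0 := by simpa [nsq] using h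
  refine eq_zero_of_nsq_le_zero ?_
  unfold qV at h0
  by_contra hne
  push Not at hne
  have : 0 < (((n : ℝ) * L) ^ d)⁻¹ * nsq f' := mul_pos (inv_pos.mpr hnd) hne
  linarith

end Ker

/-! ## §4 The effective operators of the canonical pair and the op-norm END -/

section End

variable (n L : ℕ) [NeZero n] [NeZero L] (M : Fin d → ℕ) [hM : ∀ μ, NeZero (M μ)]

/-- **`X_k(Ū′)`** — the Hermitian effective operator of `Δ′_k(Ū′)(μ) = min {Sc_{Rc} f : Q_T f = μ}` on the unit torus (auxiliary
`a > 0`; the matrix does not depend on it, `effOp_eq_effOp`). [folklore] -/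
def effSc (Rc : Tor (fine n M) → Fin d → ℂ) (T : Tor (fine n M) → ℂ) (a : ℝ) : Matrix (Tor M) (Tor M) ℂ :=
  effOp ((((n : ℝ) ^ 2 / (n : ℝ) ^ d : ℝ) : ℂ) • Kdir (fine n M) Rc) (QTm n M T) a

/-- **`X_{k+1}(U′)`** — the Hermitian effective operator of `Δ′_{k+1}(U′)(μ) = min {Sf_{R′} f′ : Q_T (Q_{T′} f′) = μ}`. [folklore] -/
def effSf (R' : Tor (fine L (fine n M)) → Fin d → ℂ) (T : Tor (fine n M) → ℂ) (T' : Tor (fine L (fine n M)) → ℂ) (a : ℝ) :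
    Matrix (Tor M) (Tor M) ℂ :=
  effOp (((((n : ℝ) * L) ^ 2 / ((n : ℝ) * L) ^ d : ℝ) : ℂ) • Kdir (fine L (fine n M)) R') (QTm n M T * QTm L (fine n M) T') a

omit [NeZero L] in
/-- `X_k(Ū′)` is Hermitian. [folklore] -/
theorem effSc_isHermitian {Rc : Tor (fine n M) → Fin d → ℂ} {T : Tor (fine n M) → ℂ} (hT : ∀ x, ‖T x‖ = 1) {CP a : ℝ}
    (hPc : ∀ f, qW n M f ≤ CP * (Sc n M Rc f + nsq (Qk n M T f))) (ha : 0 < a) : (effSc n M Rc T a).IsHermitian :=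
  effOp_isHermitian (smul_Kdir_posSemidef _ (by positivity) Rc) (QTm_mulVec_surjective n M hT) (ker_coarse n M hPc) ha

/-- `X_{k+1}(U′)` is Hermitian. [folklore] -/
theorem effSf_isHermitian {R' : Tor (fine L (fine n M)) → Fin d → ℂ} {T : Tor (fine n M) → ℂ} (hT : ∀ x, ‖T x‖ = 1)
    {T' : Tor (fine L (fine n M)) → ℂ} (hT' : ∀ x, ‖T' x‖ = 1) {CP a : ℝ}
    (hPf : ∀ f', qV n L M f' ≤ CP * (Sf n L M R' f' + nsq (Qk n M T (Q1 n L M T' f')))) (ha : 0 < a) :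
    (effSf n L M R' T T' a).IsHermitian :=
  effOp_isHermitian (smul_Kdir_posSemidef _ (by positivity) R') (QTm_comp_mulVec_surjective n M L hT hT')
    (ker_fine n L M hPf) ha

omit [NeZero L] in
/-- **LEAF D, level `n`**: `Δ′_k(Ū′)(μ) = T_{Q_T} Sc (μ) = re μ† X_k(Ū′) μ`. [folklore] -/
theorem blockSpin_Sc_eq {Rc : Tor (fine n M) → Fin d → ℂ} {T : Tor (fine n M) → ℂ} (hT : ∀ x, ‖T x‖ = 1) {CP a : ℝ}
    (hPc : ∀ f, qW n M f ≤ CP * (Sc n M Rc f + nsq (Qk n M T f))) (ha : 0 < a) (μ : Tor M → ℂ) :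
    blockSpin (Qk n M T) (Sc n M Rc) μ = (star μ ⬝ᵥ (effSc n M Rc T a *ᵥ μ)).re := by
  rw [Qk_eq_mulVec, Sc_eq_qform]
  exact blockSpin_eq_effOp (smul_Kdir_posSemidef _ (by positivity) Rc) (QTm_mulVec_surjective n M hT) (ker_coarse n M hPc) ha μ

/-- **LEAF D, composite level `nL`**: `Δ′_{k+1}(U′)(μ) = T_{Q_T∘Q_{T′}} Sf (μ) = re μ† X_{k+1}(U′) μ`. [folklore] -/
theorem blockSpin_Sf_eq {R' : Tor (fine L (fine n M)) → Fin d → ℂ} {T : Tor (fine n M) → ℂ} (hT : ∀ x, ‖T x‖ = 1)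
    {T' : Tor (fine L (fine n M)) → ℂ} (hT' : ∀ x, ‖T' x‖ = 1) {CP a : ℝ}
    (hPf : ∀ f', qV n L M f' ≤ CP * (Sf n L M R' f' + nsq (Qk n M T (Q1 n L M T' f')))) (ha : 0 < a) (μ : Tor M → ℂ) :
    blockSpin (Qk n M T ∘ Q1 n L M T') (Sf n L M R') μ = (star μ ⬝ᵥ (effSf n L M R' T T' a *ᵥ μ)).re := by
  rw [Qk_comp_Q1_eq_mulVec, Sf_eq_qform]
  exact blockSpin_eq_effOp (smul_Kdir_posSemidef _ (by positivity) R') (QTm_comp_mulVec_surjective n M L hT hT')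
    (ker_fine n L M hPf) ha μ

/-- **THE OP-NORM END FROM THE BRACKET**: unimodular transports, leaf-P⁺-shaped coercivity at both levels, and the two one-sided additive
brackets between `Δ′_k(Ū′) = T_{Q_T} Sc` and `Δ′_{k+1}(U′) = T_{Q_T∘Q_{T′}} Sf` with defects `e·nsq μ`, `e′·nsq μ` (the conclusion SHAPE of
`scalar_pair_bracket`) ⟹ `‖X_{k+1}(U′) − X_k(Ū′)‖ ≤ max e e′`. [folklore] -/
theorem opNorm_effSf_sub_effSc_le_of_bracket {Rc : Tor (fine n M) → Fin d → ℂ} {R' : Tor (fine L (fine n M)) → Fin d → ℂ}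
    {T : Tor (fine n M) → ℂ} (hT : ∀ x, ‖T x‖ = 1) {T' : Tor (fine L (fine n M)) → ℂ} (hT' : ∀ x, ‖T' x‖ = 1) {CP CP' a e e' : ℝ}
    (hPc : ∀ f, qW n M f ≤ CP * (Sc n M Rc f + nsq (Qk n M T f)))
    (hPf : ∀ f', qV n L M f' ≤ CP' * (Sf n L M R' f' + nsq (Qk n M T (Q1 n L M T' f')))) (ha : 0 < a) (he : 0 ≤ e)
    (hbr : ∀ μ, blockSpin (Qk n M T) (Sc n M Rc) μ ≤ blockSpin (Qk n M T ∘ Q1 n L M T') (Sf n L M R') μ + e * nsq μ ∧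
      blockSpin (Qk n M T ∘ Q1 n L M T') (Sf n L M R') μ ≤ blockSpin (Qk n M T) (Sc n M Rc) μ + e' * nsq μ) :
    ‖effSf n L M R' T T' a - effSc n M Rc T a‖ ≤ max e e' := by
  refine opNorm_effOp_sub_le_of_bracket (smul_Kdir_posSemidef _ (by positivity) Rc) (QTm_mulVec_surjective n M hT)
    (ker_coarse n M hPc) (smul_Kdir_posSemidef _ (by positivity) R') (QTm_comp_mulVec_surjective n M L hT hT')
    (ker_fine n L M hPf) ha he fun μ => ?_
  rw [← Qk_eq_mulVec, ← Qk_comp_Q1_eq_mulVec, ← Sc_eq_qform, ← Sf_eq_qform]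
  exact hbr μ

/-- **THE CANONICAL PAIR IN ROW NE2's CONSUMER CURRENCY, MODULO UB⁺/ONE⁺/REG⁺** — `VariationalCovariantScalarPair.scalar_pair_bracket`
read through leaf D: under exactly its hypotheses (King's charged scalar: U(1) bond phases `Rc` at level `n`, `R′` at level `nL`, site
transports `T′` unimodular, global unitary frames with the small-field conditions, mismatch absorption `512d²(n·m)² ≤ ½`; leaves UB⁺ (both
levels), ONE⁺, REG⁺ ASSUMED in their typed shapes; FED⁺/P⁺ discharged inside) plus unimodular `T` and an auxiliary `a > 0`:
`‖X_{k+1}(U′) − X_k(Ū′)‖_op ≤ max e e′`, `e = 2δ√(ΛC_P(Λ+1)) + δ²C_P(Λ+1)`, `δ = √d·(n·m)`, `C_P = 1088d + 128`, `e′ = (ε₁C_R + ε₂C_P)(Λ+1)`.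
Nothing of NE3; no propagator localisation; NE2 NOT proved. [folklore] -/
theorem opNorm_scalarPair_le {Rc : Tor (fine n M) → Fin d → ℂ} {R' : Tor (fine L (fine n M)) → Fin d → ℂ}
    {T G : Tor (fine n M) → ℂ} {T' G' : Tor (fine L (fine n M)) → ℂ} {c : Tor M → ℂ} {c' : Tor (fine n M) → ℂ}
    (hT : ∀ x, ‖T x‖ = 1) (hG : ∀ x, ‖G x‖ = 1) (hc : ∀ z, ‖c z‖ ≤ 1) {mG mB : ℝ}
    (hframe : ∀ x μ, ‖G (x + unitVec (fine n M) μ) - G x * Rc x μ‖ ≤ mG)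
    (hblock : ∀ z j, ‖G (bpt n M z j) - c z * T (bpt n M z j)‖ ≤ mB)
    (hsmall : 16 * (d : ℝ) ^ 2 * ((n : ℝ) * mG) ^ 2 + 4 * mB ^ 2 ≤ 1 / 2)
    (hG' : ∀ x, ‖G' x‖ = 1) (hc' : ∀ y, ‖c' y‖ ≤ 1) {mG' mB' : ℝ}
    (hframe' : ∀ x μ, ‖G' (x + unitVec (fine L (fine n M)) μ) - G' x * R' x μ‖ ≤ mG')
    (hblock' : ∀ y j, ‖G' (bpt L (fine n M) y j) - c' y * T' (bpt L (fine n M) y j)‖ ≤ mB')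
    (hsmall' : 16 * (d : ℝ) ^ 2 * ((L : ℝ) * mG') ^ 2 + 4 * mB' ^ 2 ≤ 1 / 2)
    (hR' : ∀ x μ, ‖R' x μ‖ ≤ 1) (hT' : ∀ x, ‖T' x‖ ≤ 1) (hT1 : ∀ x, ‖T' x‖ = 1) {m : ℝ} (hm : 0 ≤ m)
    (hmis : ∀ y μ j, ‖mis L (fine n M) Rc R' T' y μ j‖ ≤ m) (habsorb : 512 * (d : ℝ) ^ 2 * ((n : ℝ) * m) ^ 2 ≤ 1 / 2)
    {Λ CR ε₁ ε₂ : ℝ} (hΛ : 0 ≤ Λ) (hCR : 0 ≤ CR) (hε₁ : 0 ≤ ε₁) (hε₂ : 0 ≤ ε₂) {ρ : (Tor (fine n M) → ℂ) → ℝ}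
    (hUBc : ∀ μ : Tor M → ℂ, ∃ f, Qk n M T f = μ ∧ Sc n M Rc f ≤ Λ * nsq μ)
    (hUBf : ∀ μ : Tor M → ℂ, ∃ f', Qk n M T (Q1 n L M T' f') = μ ∧ Sf n L M R' f' ≤ Λ * nsq μ)
    (hONE : ∀ f, blockSpin (Q1 n L M T') (Sf n L M R') f ≤ Sc n M Rc f + ε₁ * ρ f + ε₂ * qW n M f)
    (hREG : ∀ (μ : Tor M → ℂ) f, Qk n M T f = μ → (∀ g, Qk n M T g = μ → Sc n M Rc f ≤ Sc n M Rc g) →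
      ρ f ≤ CR * (Sc n M Rc f + nsq μ))
    {a : ℝ} (ha : 0 < a) :
    ‖effSf n L M R' T T' a - effSc n M Rc T a‖
      ≤ max (2 * (Real.sqrt d * ((n : ℝ) * m)) * Real.sqrt (Λ * ((1088 * d + 128) * (Λ + 1)))
              + (Real.sqrt d * ((n : ℝ) * m)) ^ 2 * ((1088 * d + 128) * (Λ + 1)))
            ((ε₁ * CR + ε₂ * (1088 * d + 128)) * (Λ + 1)) := by
  refine opNorm_effSf_sub_effSc_le_of_bracket n L M hT hT1
    (fun f => qW_le_coarse n M hG hc hframe hblock hsmall f)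
    (fun f' => qV_le_composite n L M hG hc hframe hblock hsmall hG' hc' hframe' hblock' hsmall' hR' hT' hm hmis habsorb f')
    ha (by positivity) fun μ => ?_
  exact scalar_pair_bracket n L M hG hc hframe hblock hsmall hG' hc' hframe' hblock' hsmall' hR' hT' hT1 hm hmis habsorb
    hΛ hCR hε₁ hε₂ hUBc hUBf hONE hREG μ

end End

end Summit.QuantumFields.BalabanUV.T4Continuum.VariationalCovariantEffective

end
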